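import Summits.QuantumFields.YangMills.Theorems.BalabanUVNodesN09BackgroundRadiiTransfer
import Summits.QuantumFields.YangMills.Theorems.BalabanUVNodesN09AxialCovariance181

/-!
# NODE N09 AT THE STAGE-13 v1.7 `SepCoPH` RECORD — THE TWO RADII OF RECORD, FILE 2: [B11] Theorem 1's RESTRICTION binder `hres` («the global minimiser restricts»)
# and the INTERMEDIATE-LEVEL uniqueness binder `huniq` move from the background radius `εbg` to the cut-off radius `εreg ≤ εbg` along the SAME level-`k` (8)-membership clause —
# so the whole [B11] ×3 package `h11 ∕ hres ∕ huniq` of N09's Theorem-3 member is available at ONE radius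

TRACK A (YM-PLAN §2d, node N09 of 28), seat `pub-ymgap-dag-n09-w1` (D-0149 width seat 1∕4, generation 2), FILE 2 over this seat's FILE 1 `BalabanUVNodesN09BackgroundRadiiTransfer`
(p594365) and n09-w2 g2's `BalabanUVNodesN09AxialCovariance181` (`uniqueUkOrbit_gaugeAct_iff`: the unique-orbit set is gauge-stable, cited BY NAME) — `--supports` K1⁷
stmt-QuantumFields-20542 as a helper.  [I] = [Balaban1987RG1] (CMP 109), [B11] = [Balaban1985Variational] (CMP 102).  THEOREMS ONLY (0 `def`, 0 `sorry`).

WHY.  FILE 1 moved solvability and uniqueness AT LEVEL `k` (`h11`) from `εbg` to `εreg`.  N09's member also displays, at radius `εbg`, [B11] Thm 1's two binders about the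
INTERMEDIATE levels `j + 1 ≤ k` of the background `U_k(V)` of a small field `V ∈ domAlt_k`: `hres : HRestrict εbg K k (domAlt k)` — «`U_k(V)` is a level-`(j+1)` minimiser over
its own average `Ū^{j+1}(U_k V)`» ([B11] Thm 1 (8)–(10) read downwards, [I] (1.1)) — and `huniq` — «the minimal orbit over `Ū^{j+1}(U_k V)` is unique».  At radius `εreg` these
concern the OTHER bare choice `U_k^{(εreg)}(V)`, which differs from `U_k^{(εbg)}(V)` by a residual gauge transformation `u` of level `k` (FILE 1 `orbitRel_Uk_Uk_of_le_of_Uk_mem`) —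
NOT residual at the finer level `j+1`.  THIS FILE transports the two binders along `u` (n09-w2 g0's `isBackground_gaugeAct_toMS`: minimisers over `W` go to minimisers over
`W^{u↾T^{(j+1)}}`; r13's `iter_gaugeAct`: `Ū^{j+1}(U^u) = (Ū^{j+1}U)^{u↾T^{(j+1)}}`) and then down the radius at level `j+1` (FILE 1's witness forms, the witness being
`U_k^{(εreg)}(V)` itself: it is `εreg`-regular at level `k`, hence at every level `j+1 ≤ k` — `bgReg_anti_level`, `η_k ≤ η_{j+1}`).
* §1 `bgReg_anti_level` (`i ≤ k`, `0 ≤ ε` ⇒ `bgReg K k ε ⊆ bgReg K i ε`), `isBackground_self_gaugeAct` (transport of «a level-`i` minimiser over ITS OWN average» along ANY fine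
  gauge transformation: n09-w2 g0's `isBackground_gaugeAct_toMS` + r13's `iter_gaugeAct`).  The gauge-stability of the unique-orbit set is n09-w2 g2's `uniqueUkOrbit_gaugeAct_iff`
  (used at `v := u↾T^{(j+1)}`).
* §2 ★ `hRestrict_εreg_of_thm1_εbg_of_reg8` (`hres` at `εreg` from `h11` + `hres` at `εbg` + the level-`k` (8)-membership clause + `0 ≤ εreg ≤ εbg`), ★ `huniq_εreg_of_thm1_εbg_of_reg8`
  (`huniq` at `εreg` from the same + `huniq` at `εbg`), ★★ `thm1Package_εreg_of_εbg_of_reg8` (the whole package `h11 ∧ hres ∧ huniq` at `εreg`).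
* §3 the junction: n09-w3's on-domain door with ALL FOUR [B11]-type binders (`hsolv`, `h11`, `hres`, `huniq`) KEYED AT `εbg` … (already so but for `hsolv` — FILE 1 §4) — and,
  conversely, the door with the [B11] ×3 package keyed at the CUT-OFF's radius `εreg` only: `thm3Member_forall_stage13SepCoPH_onDomains_of_covariantOn_keyed_εreg` is NOT
  stated (the member reads `Uk … θ.εbg` in (0.22); re-keying the effective action's background is the record owner's one-token decision `εbg := εreg`, which FILE 1
  `wilsonBGOfRecord_εreg_eq_εbg_of_reg8` + this file show to be value- and orbit-neutral on the small-field domains).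

HONEST FRAMING: count-neutral kernel gauge∕order bookkeeping over NODE 00's definitions of record; NOTHING of Bałaban's asserted ([B11] Thm 1's clauses stay DISPLAYED, moved between
radii); NO carrier re-pointed; N09 NOT discharged; K0⁷ ∕ K1⁷ NOT closed; counts unmoved (typed 28∕28 · discharged 5∕27); one finite four-torus programme at fixed ε — R4 closes the
conditional rung `BalabanLadder.UV` only; the Yang–Mills mass gap (Clay) is NOT proved by any of this; nothing continuum ∕ ℝ⁴ ∕ OS.  THEOREMS ONLY, standard axioms.
-/

noncomputable section

namespace Summit.QuantumFields.YangMills.BalabanUVNodes.N09BackgroundRadiiTransferRestrict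

open Literature.MathematicalPhysics.QuantumFieldTheory.Balaban1983to89
open Literature.MathematicalPhysics.QuantumFieldTheory.Balaban1983to89.T4Continuum (T4Family)
open Literature.MathematicalPhysics.QuantumFieldTheory.Balaban1983to89.Node00
open Literature.MathematicalPhysics.QuantumFieldTheory.Balaban1983to89.B12GaugeOrbits021 (OrbitRel IsResidual)
open Literature.MathematicalPhysics.QuantumFieldTheory.Balaban1983to89.B12RTGaugeInvariance254 (invTransf gaugeAct_inv_gaugeAct)
open Literature.MathematicalPhysics.QuantumFieldTheory.Balaban1983to89.B16Sect1Backgrounds (toMS iter_gaugeAct)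
open Literature.MathematicalPhysics.QuantumFieldTheory.Balaban1983to89.GaugeField (gaugeAct)
open Summit.QuantumFields.YangMills.BalabanUVNodes.N09LiftInvariance29AtRecord (isBackground_gaugeAct_toMS gaugeAct_mem_bgReg toMS_invTransf)
open Summit.QuantumFields.YangMills.BalabanUVNodes.N09BackgroundRadiiTransfer
open Summit.QuantumFields.YangMills.BalabanUVNodes.N09AxialCovariance181 (uniqueUkOrbit_gaugeAct_iff)

variable {F : T4Family} {N : ℕ} [NeZero N]

/-! ## §1. Level anti-monotonicity of the plaquette classes; gauge transport of the restriction and of the unique-orbit set -/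

/-- **THE PLAQUETTE CLASSES DECREASE WITH THE LEVEL**: for `i ≤ k` and `0 ≤ ε`, `bgReg K k ε ⊆ bgReg K i ε` (`ε·η_k² ≤ ε·η_i²` since `η_k = L^{−k} ≤ L^{−i} = η_i`, `L > 1`).
[cite: Balaban1987RG1, (1.2) p.260 (bookkeeping)] -/
theorem bgReg_anti_level {K i k : ℕ} (hik : i ≤ k) {ε : ℝ} (hε : 0 ≤ ε) : bgReg F N K k ε ⊆ bgReg F N K i ε := by
  intro U hU
  rw [mem_bgReg_iff] at hU ⊢
  have hL : (1 : ℝ) ≤ (F.P K).L := by exact_mod_cast (F.P K).hL.2.le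
  have hη : (F.P K).eta k ≤ (F.P K).eta i := by
    unfold Params.eta
    exact pow_le_pow_of_le_one (inv_nonneg.2 (zero_le_one.trans hL)) (inv_le_one_of_one_le₀ hL) hik
  have hη0 : 0 ≤ (F.P K).eta k := by unfold Params.eta; positivity
  exact fun p => (hU p).trans_le (mul_le_mul_of_nonneg_left (pow_le_pow_left₀ hη0 hη 2) hε)

/-- **GAUGE TRANSPORT OF «A LEVEL-`i` MINIMISER OVER ITS OWN AVERAGE»** (`i ≤ m + K`): if `U` minimises (0.21) at level `i`, radius `ε`, over `Ū^i(U)`, then so does `U^u` over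
`Ū^i(U^u)`, for EVERY fine gauge transformation `u` (n09-w2 g0's `isBackground_gaugeAct_toMS` + r13's `iter_gaugeAct`). [cite: Balaban1987RG1, (0.21) p.256 and (1.1) p.260; Balaban1985Averaging, (11) p.19] -/
theorem isBackground_self_gaugeAct {K i : ℕ} (hi : i ≤ (F.P K).m + (F.P K).K) {ε : ℝ} {U : GaugeField (F.P K) 0 (SU N)}
    (h : IsBackground (avOfRecord F N K) (bgReg F N K i ε) i (Averaging.iter (avOfRecord F N K) i U) U) (u : GaugeTransf (F.P K) 0 (SU N)) :
    IsBackground (avOfRecord F N K) (bgReg F N K i ε) i (Averaging.iter (avOfRecord F N K) i (gaugeAct u U)) (gaugeAct u U) := by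
  rw [iter_gaugeAct (avOfRecord F N K) u U i hi]
  exact isBackground_gaugeAct_toMS hi (fun u' U' hU' => gaugeAct_mem_bgReg u' U' hU') h u



/-! ## §2. `hres` and `huniq` at the cut-off's radius `εreg` from the [B11] ×3 package at `εbg` + the level-`k` (8)-membership clause -/

/-- In the standing range: `j < k ≤ K ⇒ j + 1 ≤ m + K` on the `K`-th torus of the family. [cite: Balaban1987RG1, (0.1) p.251 (bookkeeping)] -/
theorem succ_le_range_of_le_of_lt {K k j : ℕ} (hk : k ≤ K) (hj : j < k) : j + 1 ≤ (F.P K).m + (F.P K).K := by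
  simp only [T4Continuum.T4Family.P_K]
  omega

/-- ★ **`hres` MOVES DOWN THE RADIUS**: if on the small-field domains the level-`k` problem is solvable with unique minimal orbit at radius `εbg` (`h11`), the global minimiser
restricts at radius `εbg` (`hres : HRestrict εbg`), and the background of record is `εreg`-regular (`hreg8`, the level-`k` (8)-membership clause), `0 ≤ εreg ≤ εbg`, then the
radius-`εreg` background of record restricts too: `HRestrict ν.εreg K k (domAlt_k)` — transport of `hres` along the residual `u` with `U_k^{(εreg)}(V) = U_k^{(εbg)}(V)^u`
(FILE 1), then down the radius at level `j+1` with witness `U_k^{(εreg)}(V)` itself (`εreg`-regular at level `k`, hence at level `j+1`).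
[cite: Balaban1985Variational, Thm 1 (6) and (8) p.279; Balaban1987RG1, (1.1)–(1.2) p.260] -/
theorem hRestrict_εreg_of_thm1_εbg_of_reg8 (ν : Stage7Numerics) (εbg : ℝ) (K : ℕ)
    (h11 : ∀ k, k ≤ K → ∀ V ∈ domAltOfRecord F N ν K k, UkExists F N K k εbg V ∧ UniqueUkOrbit F N K k εbg V)
    (hres : ∀ k, k ≤ K → HRestrict F N εbg K k (domAltOfRecord F N ν K k))
    (hreg8 : ∀ k, k ≤ K → ∀ V ∈ domAltOfRecord F N ν K k, Uk F N K k εbg V ∈ bgReg F N K k ν.εreg)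
    (hle : ν.εreg ≤ εbg) (hεreg : 0 ≤ ν.εreg) :
    ∀ k, k ≤ K → HRestrict F N ν.εreg K k (domAltOfRecord F N ν K k) := by
  intro k hk V hV j hj
  obtain ⟨hex, hu⟩ := h11 k hk V hV
  have hreg := hreg8 k hk V hV
  obtain ⟨u, -, hEq⟩ := orbitRel_Uk_Uk_of_le_of_Uk_mem hle hex hreg hu
  have hB := isBackground_self_gaugeAct (succ_le_range_of_le_of_lt hk hj) (hres k hk V hV j hj) u
  rw [← hEq] at hB
  exact isBackground_of_le_of_mem hle hB (bgReg_anti_level (by omega) hεreg (Uk_mem_bgReg (ukExists_of_le_of_Uk_mem hle hex hreg)))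

/-- ★ **`huniq` MOVES DOWN THE RADIUS**: under the same inputs plus `huniq` at `εbg` («the minimal orbit over `Ū^{j+1}(U_k^{(εbg)} V)` is unique at radius `εbg`», `j < k`),
the minimal orbit over `Ū^{j+1}(U_k^{(εreg)} V)` is unique at radius `ν.εreg` — §1's gauge transport of the unique-orbit set along `u↾T^{(j+1)}` (`Ū^{j+1}(U^u) =
(Ū^{j+1}U)^{u↾T^{(j+1)}}`), then FILE 1's witness-form uniqueness transfer with witness `U_k^{(εreg)}(V)`.
[cite: Balaban1985Variational, Thm 1 (6) and (8) p.279; Balaban1987RG1, (1.1) p.260; Balaban1985Averaging, (11) p.19] -/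
theorem huniq_εreg_of_thm1_εbg_of_reg8 (ν : Stage7Numerics) (εbg : ℝ) (K : ℕ)
    (h11 : ∀ k, k ≤ K → ∀ V ∈ domAltOfRecord F N ν K k, UkExists F N K k εbg V ∧ UniqueUkOrbit F N K k εbg V)
    (hres : ∀ k, k ≤ K → HRestrict F N εbg K k (domAltOfRecord F N ν K k))
    (huniq : ∀ k, k ≤ K → ∀ V ∈ domAltOfRecord F N ν K k, ∀ j < k,
      UniqueUkOrbit F N K (j + 1) εbg (Averaging.iter (avOfRecord F N K) (j + 1) (Uk F N K k εbg V)))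
    (hreg8 : ∀ k, k ≤ K → ∀ V ∈ domAltOfRecord F N ν K k, Uk F N K k εbg V ∈ bgReg F N K k ν.εreg)
    (hle : ν.εreg ≤ εbg) (hεreg : 0 ≤ ν.εreg) :
    ∀ k, k ≤ K → ∀ V ∈ domAltOfRecord F N ν K k, ∀ j < k,
      UniqueUkOrbit F N K (j + 1) ν.εreg (Averaging.iter (avOfRecord F N K) (j + 1) (Uk F N K k ν.εreg V)) := by
  intro k hk V hV j hj
  obtain ⟨hex, hu⟩ := h11 k hk V hV
  have hreg := hreg8 k hk V hV
  obtain ⟨u, -, hEq⟩ := orbitRel_Uk_Uk_of_le_of_Uk_mem hle hex hreg hu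
  have hj' := succ_le_range_of_le_of_lt (F := F) hk hj
  have hu' : UniqueUkOrbit F N K (j + 1) εbg (Averaging.iter (avOfRecord F N K) (j + 1) (Uk F N K k ν.εreg V)) := by
    rw [hEq, iter_gaugeAct (avOfRecord F N K) u _ (j + 1) hj']
    exact (uniqueUkOrbit_gaugeAct_iff hj' εbg (toMS u (j + 1)) _).2 (huniq k hk V hV j hj)
  have hB := isBackground_self_gaugeAct hj' (hres k hk V hV j hj) u
  rw [← hEq] at hB
  exact uniqueUkOrbit_of_le_of_isBackground_mem hle hB
    (bgReg_anti_level (by omega) hεreg (Uk_mem_bgReg (ukExists_of_le_of_Uk_mem hle hex hreg))) hu'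

/-- ★★ **THE WHOLE [B11] PACKAGE OF N09's MEMBER AT THE CUT-OFF's RADIUS**: on the small-field domains, `h11 ∕ hres ∕ huniq` at the background radius `εbg` together with the
level-`k` (8)-membership clause `hreg8` and `0 ≤ εreg ≤ εbg` give `h11 ∕ hres ∕ huniq` at radius `ν.εreg` (FILE 1 `thm1_εreg_of_h11_of_reg8` + §2) — the kernel fact behind the
record owner's option «ONE radius `εbg := εreg`»: nothing the member reads at `εbg` is lost at `εreg`. [cite: Balaban1985Variational, Thm 1 (6) and (8) p.279; Balaban1987RG1, (1.1)–(1.2) p.260] -/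
theorem thm1Package_εreg_of_εbg_of_reg8 (ν : Stage7Numerics) (εbg : ℝ) (K : ℕ)
    (h11 : ∀ k, k ≤ K → ∀ V ∈ domAltOfRecord F N ν K k, UkExists F N K k εbg V ∧ UniqueUkOrbit F N K k εbg V)
    (hres : ∀ k, k ≤ K → HRestrict F N εbg K k (domAltOfRecord F N ν K k))
    (huniq : ∀ k, k ≤ K → ∀ V ∈ domAltOfRecord F N ν K k, ∀ j < k,
      UniqueUkOrbit F N K (j + 1) εbg (Averaging.iter (avOfRecord F N K) (j + 1) (Uk F N K k εbg V)))
    (hreg8 : ∀ k, k ≤ K → ∀ V ∈ domAltOfRecord F N ν K k, Uk F N K k εbg V ∈ bgReg F N K k ν.εreg)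
    (hle : ν.εreg ≤ εbg) (hεreg : 0 ≤ ν.εreg) :
    (∀ k, k ≤ K → ∀ V ∈ domAltOfRecord F N ν K k, UkExists F N K k ν.εreg V ∧ UniqueUkOrbit F N K k ν.εreg V) ∧
      (∀ k, k ≤ K → HRestrict F N ν.εreg K k (domAltOfRecord F N ν K k)) ∧
      (∀ k, k ≤ K → ∀ V ∈ domAltOfRecord F N ν K k, ∀ j < k,
        UniqueUkOrbit F N K (j + 1) ν.εreg (Averaging.iter (avOfRecord F N K) (j + 1) (Uk F N K k ν.εreg V))) :=
  ⟨thm1_εreg_of_h11_of_reg8 ν εbg K h11 hreg8 hle, hRestrict_εreg_of_thm1_εbg_of_reg8 ν εbg K h11 hres hreg8 hle hεreg,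
    huniq_εreg_of_thm1_εbg_of_reg8 ν εbg K h11 hres huniq hreg8 hle hεreg⟩

end Summit.QuantumFields.YangMills.BalabanUVNodes.N09BackgroundRadiiTransferRestrict

end
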